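import Mathlib
import Literature.Computability.Complexity.Classes
import Literature.Computability.Complexity.Nondeterministic
import Literature.Computability.Complexity.BoolEncodings
import Literature.Computability.Complexity.CNF
import Literature.Computability.MetaComplexity.ProofSystems
import Literature.Computability.MetaComplexity.Frege
import Literature.Computability.Cryptography.OneWayFunctions
import Summits.PneNP.PneNP.Theorems.LatticeMagicTargetIffNPneCoNP

/-!
# Sketch (ideator 5, round 2) — crux `Target` of route LatticeMagic (stmt-PneNP-10709)

Card `kpt-squeeze-ideal-lattice-leg`: Krajíček's model-extension squeeze
(MEP ∧ (ST) ⟹ NP ≠ coNP, arXiv:2506.20221 Thm 4.1) with the cryptographic leg (ST) supplied by an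
INJECTIVE one-way family whose injectivity is meta-provable — the ideal-lattice / partial-NTT
syndrome map, injective by the AM–GM bound `λ₁(I) ≥ √n · N(I)^{1/n}`.

Contents (all statements elaborate; ONE `sorry` — the first lemma; the AM–GM certificate is PROVED):
* the Student–Teacher HARD-BIT VECTOR GAME for a function `g` with predicate `B` (`STGameHard`);
* FIRST LEMMA `stGameHard_of_oneWay`: a (uniform, strong) one-way `g` with hard-core bit `B` makes
  the game unwinnable for p-time students in O(1) rounds (no injectivity/permutation needed here;
  injectivity is needed only to turn game instances into DD_P instances, `STHyp` below);
* Krajíček's hypothesis (ST) typed over the tree's Cook–Reckhow proof systems (`STHyp`, `ST`);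
* the AM–GM minimum bound for ideals of number rings (`ideal_embedding_sq_sum_ge`, PROVED, no sorry),
  the injectivity certificate of the lattice leg;
* the composition through the LANDED bridge `latticeMagicTarget_of_NP_ne_coNP`.
-/

namespace Summit.PneNP.PneNP.Cruxes.Target.Ideator5

open Literature.Computability.Complexity Literature.Computability.Cryptography
open Literature.Computability.MetaComplexity
open _root_.Computability

/-! ### 1. The Student–Teacher hard-bit vector game -/

/-- Flatten a list of strings with the tree's self-delimiting pairing. -/
def flat : List (List Bool) → List Bool
  | [] => []
  | x :: xs => boolPair x (flat xs)

/-- An instance: `t` hidden strings `u j` (the student is shown `w j = g (u j)`). -/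
structure HBInstance (t : ℕ) where
  u : Fin t → List Bool

variable {t : ℕ}

/-- What the student sees before a round: the images and the counterexamples revealed so far
(coordinate index in unary, preimage). -/
def hbView (g : List Bool → List Bool) (I : HBInstance t) (hist : List (ℕ × List Bool)) :
    List Bool :=
  boolPair (flat (List.ofFn fun j => g (I.u j)))
    (flat (hist.map fun p => boolPair (unaryEncodeNat p.1) p.2))

/-- Coordinate `j` of the proposal `v` is wrong: `B (u j) ≠ v_j` (junk bit `false` beyond `|v|`). -/
def Wrong (B : List Bool → Bool) (I : HBInstance t) (v : List Bool) (j : Fin t) : Prop :=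
  B (I.u j) ≠ v.getD j false

/-- A teacher: given the round's proposal and the history, names a coordinate to reveal. -/
abbrev Teacher (t : ℕ) : Type := List Bool → List (ℕ × List Bool) → Fin t

/-- History after `r` rounds of the student `S` against the teacher `T`. -/
def hbHist (g : List Bool → List Bool) (S : List Bool → List Bool) (T : Teacher t)
    (I : HBInstance t) : ℕ → List (ℕ × List Bool)
  | 0 => []
  | r + 1 =>
    let h := hbHist g S T I r
    let v := S (hbView g I h)
    let j := T v h
    h ++ [((j : ℕ), I.u j)]

/-- The student's proposal in round `r`. -/
def hbProposal (g : List Bool → List Bool) (S : List Bool → List Bool) (T : Teacher t)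
    (I : HBInstance t) (r : ℕ) : List Bool :=
  S (hbView g I (hbHist g S T I r))

/-- The teacher is legal for `k` rounds: whenever the proposal has a wrong coordinate she
reveals a wrong one (which one is her choice — that is the adversarial freedom). -/
def HBLegal (g : List Bool → List Bool) (B : List Bool → Bool) (S : List Bool → List Bool)
    (T : Teacher t) (I : HBInstance t) (k : ℕ) : Prop :=
  ∀ r < k, (∃ j, Wrong B I (hbProposal g S T I r) j) →
    Wrong B I (hbProposal g S T I r) (T (hbProposal g S T I r) (hbHist g S T I r))

/-- The student wins within `k` rounds: some proposal is entirely correct. -/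
def HBWins (g : List Bool → List Bool) (B : List Bool → Bool) (S : List Bool → List Bool)
    (T : Teacher t) (I : HBInstance t) (k : ℕ) : Prop :=
  ∃ r < k, ∀ j, ¬ Wrong B I (hbProposal g S T I r) j

/-- The hard-bit vector game for `(g, B)` is hard for p-time students with constantly many
rounds: for every `k` and every `S ∈ FP` and arbitrarily large `n` there is an instance of `2k+2`
hidden strings of length `n` and a legal teacher against which `S` does not win within `k` rounds. -/
def STGameHard (g : List Bool → List Bool) (B : List Bool → Bool) : Prop :=
  ∀ k : ℕ, ∀ S : List Bool → List Bool, S ∈ FP → ∀ n₀ : ℕ, ∃ n, n₀ ≤ n ∧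
    ∃ I : HBInstance (2 * k + 2), (∀ j, (I.u j).length = n) ∧
      ∃ T : Teacher (2 * k + 2), HBLegal g B S T I k ∧ ¬ HBWins g B S T I k

/-- **FIRST LEMMA (card `kpt-squeeze-ideal-lattice-leg`).** A strong one-way function with a
hard-core predicate makes the hard-bit vector game hard for p-time students with O(1) rounds.
Proof sketch (card, §Lever): plant the challenge at a uniformly random coordinate `ρ` of
`t = 2k+2`, self-sample the other coordinates WITH their preimages, play the teacher "reveal the
lowest wrong coordinate `≠ ρ`", output the student's bit at `ρ` the first time all coordinates
`≠ ρ` are right; this coincides with the honest run unless `ρ` is among the `≤ k−1` revealed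
coordinates of the honest run, an event of probability `≤ (k−1)/(2k+2) < 1/2` independent of
the run — advantage `≥ 1/(k+1)` for all large `n`, contradicting `IsHardCorePredicate`.
No injectivity and no surjectivity of `g` is used. -/
theorem stGameHard_of_oneWay (g : List Bool → List Bool) (B : List Bool → Bool)
    (hg : IsOneWay g) (hB : IsHardCorePredicate B g) : STGameHard g B := by
  sorry

/-! ### 2. Krajíček's hypothesis (ST) over Cook–Reckhow proof systems -/

/-- The disjunction of a list of formulas (empty list ↦ the falsum `const false`). -/
def bigDisj : List (PropForm ℕ) → PropForm ℕ
  | [] => PropForm.const false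
  | [φ] => φ
  | φ :: l => PropForm.disj φ (bigDisj l)

/-- An input of the search problem `DD_V`: a `V`-proof `π` of a DISJOINT disjunction `⋁ l`. -/
structure DDInstance (V : List Bool → List Bool → Bool) where
  l : List (PropForm ℕ)
  π : List Bool
  disjoint : l.Pairwise fun φ ψ => Disjoint φ.vars ψ.vars
  proves : V (encodingPropForm.encode (bigDisj l)) π = true

variable {V : List Bool → List Bool → Bool}

/-- The student's view: the instance and the counterexamples so far (index in unary, a falsifying
assignment presented as a bit list `a`, read as `x ↦ a.getD x false`). -/
def ddView (I : DDInstance V) (hist : List (ℕ × List Bool)) : List Bool :=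
  boolPair (boolPair I.π (flat (I.l.map encodingPropForm.encode)))
    (flat (hist.map fun p => boolPair (unaryEncodeNat p.1) p.2))

/-- A DD-teacher: given the proposed index and the history, returns an assignment. -/
abbrev DDTeacher : Type := ℕ → List (ℕ × List Bool) → List Bool

/-- History after `r` rounds (the student answers an index in unary). -/
def ddHist (S : List Bool → List Bool) (T : DDTeacher) (I : DDInstance V) :
    ℕ → List (ℕ × List Bool)
  | 0 => []
  | r + 1 =>
    let h := ddHist S T I r
    let i := unaryDecodeNat (S (ddView I h))
    h ++ [(i, T i h)]

/-- The index proposed in round `r`. -/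
def ddProposal (S : List Bool → List Bool) (T : DDTeacher) (I : DDInstance V) (r : ℕ) : ℕ :=
  unaryDecodeNat (S (ddView I (ddHist S T I r)))

/-- Legal teacher for `k` rounds: a proposed non-tautology is answered by a falsifying assignment. -/
def DDLegal (S : List Bool → List Bool) (T : DDTeacher) (I : DDInstance V) (k : ℕ) : Prop :=
  ∀ r < k, ∀ φ, I.l[ddProposal S T I r]? = some φ → ¬ φ.IsTautology →
    φ.eval (fun x => (T (ddProposal S T I r) (ddHist S T I r)).getD x false) = false

/-- The student wins within `k` rounds: some proposed disjunct is a tautology. -/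
def DDWins (S : List Bool → List Bool) (T : DDTeacher) (I : DDInstance V) (k : ℕ) : Prop :=
  ∃ r < k, ∃ φ, I.l[ddProposal S T I r]? = some φ ∧ φ.IsTautology

/-- `DD_V ∉ ST[FP, O(1)]`: no p-time student solves `DD_V` in constantly many rounds
(Krajíček, arXiv:2506.20221 §2, Hypothesis (ST), for the system `V`). -/
def STHyp (V : List Bool → List Bool → Bool) : Prop :=
  ∀ k : ℕ, ∀ S : List Bool → List Bool, S ∈ FP →
    ∃ I : DDInstance V, ∃ T : DDTeacher, DDLegal S T I k ∧ ¬ DDWins S T I k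

/-- Hypothesis (ST) relative to a reference system `E` (intended: an Extended Frege verifier):
some proof system for `TAUT` p-simulating `E` has an ST-hard `DD` problem. ("strong pps" =
EF + a p-time set of tautological axioms, loc. cit.; the closure conditions are left to the
crux-plan seat.) -/
def ST (E : List Bool → List Bool → Bool) : Prop :=
  ∃ V, IsProofSystemFor V TAUT ∧ PSimulates V E ∧ STHyp V

/-- SECOND LEMMA (shape only; the bridge from the game to (ST)): if `g` is moreover INJECTIVE and
length-regular, the hard-bit vector game instances are `D_P`-instances of the strong system
`P := E + {‖g is injective on {0,1}ⁿ‖ : n}` (the injectivity formulas are tautologies BECAUSE `g`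
is injective — meta-provability, not `E`-provability, is what is needed), and `DD_P ∉ ST[FP,O(1)]`
follows by Krajíček's Lemma 2.1 (`DD_P` vs `D_P`). Stated here with the construction of `P`
abstracted into the hypothesis `hP`. -/
theorem st_of_stGameHard_injective (E : List Bool → List Bool → Bool)
    (g : List Bool → List Bool) (B : List Bool → Bool)
    (hinj : Function.Injective g) (hreg : IsLengthRegular g) (hgame : STGameHard g B)
    (hP : ∃ P, IsProofSystemFor P TAUT ∧ PSimulates P E ∧ (STGameHard g B → STHyp P)) :
    ST E := by
  obtain ⟨P, hP1, hP2, hP3⟩ := hP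
  exact ⟨P, hP1, hP2, hP3 hgame⟩

/-! ### 3. The lattice leg: AM–GM injectivity certificate for ideal lattices -/

open NumberField in
/-- **AM–GM minimum bound.** For a nonzero `x` in an ideal `I` of the ring of integers of a
number field `K` of degree `n`, `∑_σ |σ x|² ≥ n · N(I)^{2/n}` (AM–GM on the `|σ x|²` and
`N(I) ∣ |N_{K/ℚ}(x)|`). Hence the canonical-embedding minimum of `I` is `≥ √n · N(I)^{1/n}` and
the syndrome map `e ↦ e mod I` is injective on any set of diameter `< √n · N(I)^{1/n}` — the
trapdoor-free injectivity certificate of the partial-NTT map `e ↦ (e(rᵢ) mod q)_{i ≤ k}` for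
`K = ℚ(ζ_{2n})`, `I = ∏ᵢ (q, ζ − rᵢ)`, `N(I) = qᵏ`. -/
theorem ideal_embedding_sq_sum_ge (K : Type*) [Field K] [NumberField K] (I : Ideal (𝓞 K))
    (x : 𝓞 K) (hx : x ∈ I) (hx0 : x ≠ 0) :
    (Module.finrank ℚ K : ℝ) * ((Ideal.absNorm I : ℕ) : ℝ) ^ ((2 : ℝ) / (Module.finrank ℚ K : ℝ))
      ≤ ∑ σ : K →+* ℂ, ‖σ (x : K)‖ ^ 2 := by
  classical
  set n : ℕ := Module.finrank ℚ K with hn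
  have hnpos : 0 < n := Module.finrank_pos
  have hnR : (0 : ℝ) < n := by exact_mod_cast hnpos
  have hcard : Fintype.card (K →+* ℂ) = n := NumberField.Embeddings.card K ℂ
  -- (1) product of the |σ x| is |N(x)|
  have hprod : ∏ σ : K →+* ℂ, ‖σ (x : K)‖ = |((Algebra.norm ℚ (x : K) : ℚ) : ℝ)| := by
    rw [Fintype.prod_equiv RingHom.equivRatAlgHom (fun f => ‖f (x : K)‖)
        (fun φ => ‖φ (x : K)‖) (fun _ => by simp [RingHom.equivRatAlgHom_apply]), ← norm_prod,
        ← Algebra.norm_eq_prod_embeddings ℚ ℂ (x : K)]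
    rw [eq_ratCast, ← Complex.ofReal_ratCast, Complex.norm_real, Real.norm_eq_abs]
  -- (2) |N(x)| ≥ absNorm I
  have hNZ : ((Algebra.norm ℚ (x : K) : ℚ) : ℝ) = ((Algebra.norm ℤ x : ℤ) : ℝ) := by
    rw [← Algebra.coe_norm_int, Rat.cast_intCast]
  have hdvd : Ideal.absNorm I ∣ (Algebra.norm ℤ x).natAbs := by
    rw [← Ideal.absNorm_span_singleton]
    exact Ideal.absNorm_dvd_absNorm_of_le ((Ideal.span_singleton_le_iff_mem _).mpr hx)
  have hN0 : (Algebra.norm ℤ x).natAbs ≠ 0 := by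
    rw [Int.natAbs_ne_zero]
    exact Algebra.norm_ne_zero_iff.mpr hx0
  have hle : (Ideal.absNorm I : ℝ) ≤ |((Algebra.norm ℤ x : ℤ) : ℝ)| := by
    rw [← Int.cast_abs, ← Nat.cast_natAbs]
    exact_mod_cast Nat.le_of_dvd (Nat.pos_of_ne_zero hN0) hdvd
  -- (3) AM–GM with equal weights 1/n on z σ = ‖σ x‖²
  have hz : ∀ σ ∈ (Finset.univ : Finset (K →+* ℂ)), (0 : ℝ) ≤ ‖σ (x : K)‖ ^ 2 :=
    fun σ _ => by positivity
  have hw : ∀ σ ∈ (Finset.univ : Finset (K →+* ℂ)), (0 : ℝ) ≤ (1 / (n : ℝ)) := fun _ _ => by positivity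
  have hw' : ∑ σ ∈ (Finset.univ : Finset (K →+* ℂ)), (1 / (n : ℝ)) = 1 := by
    rw [Finset.sum_const, Finset.card_univ, hcard, nsmul_eq_mul]
    field_simp
  have hamgm := Real.geom_mean_le_arith_mean_weighted (Finset.univ : Finset (K →+* ℂ))
    (fun _ => 1 / (n : ℝ)) (fun σ => ‖σ (x : K)‖ ^ 2) hw hw' hz
  -- LHS of AM–GM = (∏ ‖σ x‖²)^(1/n) = |N|^(2/n)
  have hlhs : ∏ σ ∈ (Finset.univ : Finset (K →+* ℂ)), (‖σ (x : K)‖ ^ 2) ^ (1 / (n : ℝ))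
      = |((Algebra.norm ℤ x : ℤ) : ℝ)| ^ ((2 : ℝ) / (n : ℝ)) := by
    rw [Real.finset_prod_rpow _ _ (fun σ _ => by positivity), Finset.prod_pow, hprod, hNZ,
      ← Real.rpow_natCast, ← Real.rpow_mul (abs_nonneg _)]
    norm_num [div_eq_mul_inv]
  -- RHS of AM–GM = (1/n) Σ ‖σ x‖²
  have hrhs : ∑ σ ∈ (Finset.univ : Finset (K →+* ℂ)), (1 / (n : ℝ)) * ‖σ (x : K)‖ ^ 2
      = (1 / (n : ℝ)) * ∑ σ : K →+* ℂ, ‖σ (x : K)‖ ^ 2 := by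
    rw [Finset.mul_sum]
  rw [hlhs, hrhs] at hamgm
  -- (4) combine: n · (absNorm I)^(2/n) ≤ n · |N|^(2/n) ≤ Σ
  have hexp : (0 : ℝ) ≤ 2 / (n : ℝ) := by positivity
  have hmono : ((Ideal.absNorm I : ℕ) : ℝ) ^ ((2 : ℝ) / (n : ℝ))
      ≤ |((Algebra.norm ℤ x : ℤ) : ℝ)| ^ ((2 : ℝ) / (n : ℝ)) :=
    Real.rpow_le_rpow (by positivity) hle hexp
  calc (n : ℝ) * ((Ideal.absNorm I : ℕ) : ℝ) ^ ((2 : ℝ) / (n : ℝ))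
      ≤ (n : ℝ) * |((Algebra.norm ℤ x : ℤ) : ℝ)| ^ ((2 : ℝ) / (n : ℝ)) :=
        mul_le_mul_of_nonneg_left hmono hnR.le
    _ ≤ ∑ σ : K →+* ℂ, ‖σ (x : K)‖ ^ 2 := by
        have := mul_le_mul_of_nonneg_left hamgm hnR.le
        rwa [← mul_assoc, mul_one_div_cancel hnR.ne', one_mul] at this

/-! ### 4. Composition through the landed bridge -/

/-- The line's shape: Krajíček's Thm 4.1 (MEP ∧ (ST) → NP ≠ coNP, here the hypothesis `hsqueeze`
with MEP folded in) and the landed `Target ↔ NP ≠ coNP` give `Target` from (ST). -/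
theorem target_of_squeeze (E : List Bool → List Bool → Bool)
    (hsqueeze : ST E → Nondeterministic.NP ≠ coNP) (hST : ST E) :
    Summit.PneNP.PneNP.Theses.LatticeMagic.Target :=
  Summit.PneNP.PneNP.Theorems.latticeMagicTarget_of_NP_ne_coNP (hsqueeze hST)

end Summit.PneNP.PneNP.Cruxes.Target.Ideator5
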